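import Summits.MatrixMultiplication.MatrixMultiplication.Theorems.TetraResidualGroupingCeiling
import Summits.MatrixMultiplication.MatrixMultiplication.Theorems.TetrahedronTensorGraphBridge
import Literature.Computability.AlgebraicComplexity.RectangularExponentAlpha
import HarnessLib

/-!
# TetraResidualAlternatives — a dominated rectangular residual, the «why K₄» arithmetic, and what the
recorded web decides about `TetraNoSaving` (decomp-mm lens 6, generation 18; residual-side kernel, part 2/2)

Continues `Theorems.TetraResidualGroupingCeiling` (the grouping-class ceiling for item 33478).

## 3. A DOMINATED alternative residual on the rectangular axis
`ω(2,1,2) = 2·ω(1,½,1)` (homogeneity), so the hypothesis `RectHalfNoSaving : ω(1,½,1) = ω` («halving the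
inner dimension saves nothing») IMPLIES `TetraNoSaving` (`tetraNoSaving_of_rectHalfNoSaving`) and gives the
exact cut `ω = 2 ⟺ TetraFlat ∧ ω(1,½,1) = ω` (`matrixMultiplication_iff_tetraFlat_and_rectHalf`) — same
attacked leaf, STRONGER residual (price `ω ≤ 2.042994` under the printed VXXZ24 row `ω(1,0.5,1) ≤ 2.042994`,
`omega_le_of_rectHalfNoSaving`; the cut of record's residual only forces `ω < 2.316954`): cut-height
conservation, recorded as a web edge to the `ω(1,y,1)` axis (FarEdgeDescent / OctaveBudget), not filed.

## 4. Why `K₄` (arithmetic of the clique carvings)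
For the clique `K_k` the bipartition flattening floor of `ω(T(K_k))` is `a·b` (`k = a + b`) and the
triangle-cover value is `(2/3)·C(k,2)` under `ω = 2`. `three_mul_cut_le`: `3ab ≤ 2·C(a+b,2)` whenever
`a + b ≥ 3`, with equality EXACTLY for `{a,b} = {1,2}` (`K₃`) and `a = b = 2` (`K₄`) (`three_mul_cut_eq_iff`,
identity `4(2C(a+b,2) − 3ab) = 3(a−b)² + (a+b)(a+b−4)`). So `ω = 2 ⟹ ω(T(K_k)) = max-cut` is forced only for
`k ≤ 4`: the tetrahedron carving is the LAST exact clique carving — for `K₅` the piece `ω(T(K₅)) ≤ 6` is not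
known to be necessary (`ω(T(K₅)) ∈ [6, 20/3]` under `ω = 2`).

## 5. Independence model (what the recorded web decides)
`K4Web` lists, as fields over three reals `(w, w212, wT) ↔ (ω, ω(2,1,2), ω(K₄))`, every inequality among
them that the tree proves (instantiated from the tree in `K4Web.ofTree`, modulo the two printed facts
`advxxz2025_omega_le`, `brandEtAl2026_thm_48`). `darkWorld = (2.37, 4, 4)` satisfies all of them AND
`TetraFlat` (`wT ≤ 4`) and violates `TetraNoSaving`; `brightWorld = (2, 4, 4)` satisfies both: the recorded
web, even with the attacked leaf granted, does not decide the residual (`web_does_not_decide_residual`) —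
the typed form of «IDEA-NEEDED: the closing inequality must come from outside the grouping class (part 1)
and outside the recorded web».

Sources: [cite: LottiRomani1983, §1 (p. 173)], [cite: ChristandlVranaZuiddam2016, Prop. 1.1.26] (clique
covers), [cite: BrandEtAl2026, Thm. 48], [cite: VassilevskaWilliamsXuXuZhou2024, §1.1 Table 1],
[cite: AlmanDuanVassilevskaWilliamsXuXuZhou2025, abstract]; tree `Theorems.TetrahedronTensorRectangular`,
`Theorems.ConeTensorResidual`, `Theorems.TetrahedronTensorGraphBridge`.
-/

noncomputable section

set_option linter.dupNamespace false

open scoped BigOperators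
open Literature.Computability.AlgebraicComplexity
open Summit.MatrixMultiplication.MatrixMultiplication.Theorems.TetrahedronTensor
open Summit.MatrixMultiplication.MatrixMultiplication.Theorems.ConeTensor
open Summit.MatrixMultiplication.MatrixMultiplication.Theses.TetrahedronCarving
open Summit.MatrixMultiplication.MatrixMultiplication.Theorems.TetraResidualGroupingCeiling

namespace Summit.MatrixMultiplication.MatrixMultiplication.Theorems.TetraResidualAlternatives

/-! ## 3. The dominated rectangular residual `ω(1,½,1) = ω` -/

section RectHalf

variable (F : Type) [Field F]

/-- `ω(2,1,2) = 2·ω(1,½,1)` (homogeneity). [cite: LottiRomani1983, §1 (p. 173)] -/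
theorem omegaRect_two_one_two_eq_two_mul_half : omegaRect F 2 1 2 = 2 * omegaRect F 1 (1 / 2) 1 := by
  have hs := omegaRect_smul (K := F) (t := 2) (by norm_num) (a := 1) (b := 1 / 2) (c := 1)
    (by norm_num) (by norm_num) (by norm_num)
  have e1 : ((2 : ℕ) : ℝ) * 1 = 2 := by norm_num
  have e2 : ((2 : ℕ) : ℝ) * (1 / 2) = 1 := by norm_num
  have e3 : ((2 : ℕ) : ℝ) = 2 := by norm_num
  rw [e1, e2, e3] at hs
  exact hs

/-- **`RectHalfNoSaving ⟹ TetraNoSaving`**, where `RectHalfNoSaving` is the hypothesis `ω(1,½,1) = ω`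
(«halving the inner dimension saves nothing asymptotically: `⟨n, √n, n⟩` costs `n^{ω+o(1)}`», a statement
on the rectangular-profile axis `y ↦ ω(1,y,1)`): `2ω = 2ω(1,½,1) = ω(2,1,2) ≤ ω(K₄)`. The rectangular
statement is a STRONGER residual for the same attacked leaf `TetraFlat`. [folklore] -/
theorem tetraNoSaving_of_rectHalfNoSaving (h : omegaRect ℂ 1 (1 / 2) 1 = omega ℂ) : TetraNoSaving := by
  have hle := omegaRect_two_one_two_le_omegaTetra ℂ
  rw [omegaRect_two_one_two_eq_two_mul_half, h] at hle
  exact hle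

/-- **The alternative exact cut `ω = 2 ⟺ TetraFlat ∧ RectHalfNoSaving`** (`TetraFlat` gives
`ω(1,½,1) = 2`, tree `omegaRect_one_half_one_eq_two_of_omegaTetra_le_four`; conversely `ω = 2` pins both).
Same attacked leaf as the cut of record, residual dominated by it (`tetraNoSaving_of_rectHalfNoSaving`).
[folklore] -/
theorem matrixMultiplication_iff_tetraFlat_and_rectHalf :
    _root_.MatrixMultiplication ↔ TetraFlat ∧ omegaRect ℂ 1 (1 / 2) 1 = omega ℂ := by
  constructor
  · intro hS
    have hω : omega ℂ = 2 := (_root_.MatrixMultiplication_iff).1 hS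
    refine ⟨?_, ?_⟩
    · show omegaTetra ℂ ≤ 4
      have := omegaTetra_bracket.2
      rw [hω] at this
      linarith
    · show omegaRect ℂ 1 (1 / 2) 1 = omega ℂ
      have h2 : 2 ≤ omegaRect ℂ 1 (1 / 2) 1 := two_le_omegaRect_one_mid_one (K := ℂ) (1 / 2)
      have hle : omegaRect ℂ 1 (1 / 2) 1 ≤ omegaRect ℂ 1 1 1 :=
        omegaRect_one_mid_one_mono (K := ℂ) (by norm_num)
      rw [omegaRect_one_one_one, hω] at hle
      rw [hω]
      exact le_antisymm hle h2
  · rintro ⟨hA, hB⟩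
    have h2 := omegaRect_one_half_one_eq_two_of_omegaTetra_le_four ℂ hA
    rw [hB] at h2
    exact (_root_.MatrixMultiplication_iff).2 h2

/-- **The price of the rectangular residual**: under the printed row `ω(1, 0.5, 1) ≤ 2.042994` of
VXXZ24 Table 1, `RectHalfNoSaving` forces `ω ≤ 2.042994` — far beyond the record `2.371339`; the cut of
record's residual only forces `ω < 2.316954` (tree `omega_lt_of_tetraNoSaving_of_brandEtAl2026_thm_48`).
[cite: VassilevskaWilliamsXuXuZhou2024, §1.1 Table 1] -/
theorem omega_le_of_rectHalfNoSaving (htab : vxxz2024_omegaRect_table)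
    (h : omegaRect ℂ 1 (1 / 2) 1 = omega ℂ) : omega ℂ ≤ 2.042994 := by
  have row := htab 0.50 2.042994 (by norm_num [vxxz2024Table])
  have e : (0.50 : ℝ) = 1 / 2 := by norm_num
  rw [e, h] at row
  exact row

end RectHalf

/-! ## 4. Why `K₄`: the flattening floor of a clique meets the triangle rate only at `K₃` and `K₄` -/

section WhyK4

/-- `2·C(k,2) = k(k−1)`. [folklore] -/
theorem two_mul_choose_two (k : ℕ) : 2 * k.choose 2 = k * (k - 1) := by
  rw [Nat.choose_two_right, Nat.two_mul_div_two_of_even (Nat.even_mul_pred_self k)]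

/-- **`3·ab ≤ 2·C(a+b, 2)` for `a + b ≥ 3`**: the bipartition flattening floor `ab` of `ω(T(K_{a+b}))` is at
most the triangle-cover value `(2/3)·C(a+b,2)` (exponent per edge: floor `≤ 2/3`). [folklore] -/
theorem three_mul_cut_le (a b : ℕ) (h : 3 ≤ a + b) : 3 * (a * b) ≤ 2 * (a + b).choose 2 := by
  rw [two_mul_choose_two]
  obtain ⟨c, hc⟩ : ∃ c, a + b = c + 3 := ⟨a + b - 3, by omega⟩
  rw [hc, show c + 3 - 1 = c + 2 by omega]
  rcases Nat.eq_zero_or_pos c with rfl | hcpos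
  · have ha : a ≤ 3 := by omega
    interval_cases a <;> omega
  · zify at hc ⊢
    nlinarith [sq_nonneg ((a : ℤ) - b), mul_nonneg (by positivity : (0 : ℤ) ≤ c + 3)
      (by linarith : (0 : ℤ) ≤ c - 1)]

/-- **Equality `3·ab = 2·C(a+b,2)` holds exactly for `{a, b} = {1, 2}` (`K₃`) and `a = b = 2` (`K₄`)**
(for `a + b ≥ 3`): `4·(2C(a+b,2) − 3ab) = 3(a−b)² + (a+b)(a+b−4)`. So the trivial floor of `τ(K_k)` equals
the triangle rate `2/3` iff `k ∈ {3, 4}`; from `K₅` on, `ω = 2` does not pin `ω(T(K_k))` to its floor, and a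
clique carving `Flat(K_k) ∧ NoSaving` is exact only at `k = 4`. [folklore] -/
theorem three_mul_cut_eq_iff (a b : ℕ) (h : 3 ≤ a + b) :
    3 * (a * b) = 2 * (a + b).choose 2 ↔ (a = 1 ∧ b = 2) ∨ (a = 2 ∧ b = 1) ∨ (a = 2 ∧ b = 2) := by
  rw [two_mul_choose_two]
  constructor
  · intro heq
    have hle : a + b ≤ 4 := by
      by_contra hgt
      obtain ⟨c, hc⟩ : ∃ c, a + b = c + 5 := ⟨a + b - 5, by omega⟩
      rw [hc, show c + 5 - 1 = c + 4 by omega] at heq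
      zify at hc heq
      nlinarith [sq_nonneg ((a : ℤ) - b)]
    have ha : a ≤ 4 := by omega
    have hb : b ≤ 4 := by omega
    interval_cases a <;> interval_cases b <;> omega
  · rintro (⟨rfl, rfl⟩ | ⟨rfl, rfl⟩ | ⟨rfl, rfl⟩) <;> decide

/-- The two equality cliques in exponent form: `K₃` (`ω ≥ 2 = 2·3/3`, i.e. `3·(1·2) = 2·C(3,2)`) and
`K₄` (`ω(K₄) ≥ 4 = 2·6/3`, `3·(2·2) = 2·C(4,2)`), versus `K₅`: `3·(2·3) = 18 < 20 = 2·C(5,2)`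
(floor `6`, triangle value `20/3`). [folklore] -/
theorem clique_floor_examples :
    3 * (1 * 2) = 2 * (3 : ℕ).choose 2 ∧ 3 * (2 * 2) = 2 * (4 : ℕ).choose 2 ∧
      3 * (2 * 3) < 2 * (5 : ℕ).choose 2 := by
  decide

end WhyK4

/-! ## 5. What the recorded web of inequalities decides about the residual: nothing -/

section Web

/-- **The recorded web.** Three reals standing for `ω`, `ω(2,1,2)`, `ω(K₄)` together with every
inequality among them that the tree proves today (see `K4Web.ofTree`): `2 ≤ ω ≤ 2.371339` (record,
printed), `max(4, 5ω/3) ≤ ω(2,1,2) ≤ ω + 2`, `ω(2,1,2) ≤ ω(K₄)`, `4 ≤ ω(K₄) ≤ 2ω`, `ω(K₄) < 4.633908`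
(printed). [folklore] -/
structure K4Web where
  /-- stands for `ω` -/
  w : ℝ
  /-- stands for `ω(2,1,2)` -/
  w212 : ℝ
  /-- stands for `ω(T(K₄))` -/
  wT : ℝ
  two_le_w : 2 ≤ w
  w_le_record : w ≤ 2.371339
  four_le_w212 : 4 ≤ w212
  five_thirds_le_w212 : 5 / 3 * w ≤ w212
  w212_le_w_add_two : w212 ≤ w + 2
  w212_le_wT : w212 ≤ wT
  four_le_wT : 4 ≤ wT
  wT_le_two_mul_w : wT ≤ 2 * w
  wT_lt_bckloss : wT < 4.633908

/-- **Soundness of the web**: the tree's exponents satisfy every field (the two printed facts enter as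
hypotheses, as everywhere in the tree). [folklore] -/
def K4Web.ofTree (hrec : advxxz2025_omega_le) (h48 : brandEtAl2026_thm_48) : K4Web where
  w := omega ℂ
  w212 := omegaRect ℂ 2 1 2
  wT := omegaTetra ℂ
  two_le_w := omega_two_le ℂ
  w_le_record := hrec
  four_le_w212 := four_le_omegaRect_two_one_two ℂ
  five_thirds_le_w212 := five_thirds_mul_omega_le_omegaRect_two_one_two ℂ
  w212_le_w_add_two := by
    rw [omegaRect_swap₁₂ ℂ 2 1 2]
    exact omegaRect_one_two_two_le_omega_add_two ℂ
  w212_le_wT := omegaRect_two_one_two_le_omegaTetra ℂ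
  four_le_wT := omegaTetra_bracket.1
  wT_le_two_mul_w := omegaTetra_bracket.2
  wT_lt_bckloss := omegaTetra_lt_of_brandEtAl2026_thm_48 h48

/-- In the web, `TetraFlat` reads `wT ≤ 4` and `TetraNoSaving` reads `2w ≤ wT`. The DARK world
`(ω, ω(2,1,2), ω(K₄)) = (2.37, 4, 4)`: every recorded inequality holds, the attacked leaf holds, the
residual FAILS. [folklore] -/
def darkWorld : K4Web where
  w := 2.37
  w212 := 4
  wT := 4
  two_le_w := by norm_num
  w_le_record := by norm_num
  four_le_w212 := by norm_num
  five_thirds_le_w212 := by norm_num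
  w212_le_w_add_two := by norm_num
  w212_le_wT := by norm_num
  four_le_wT := by norm_num
  wT_le_two_mul_w := by norm_num
  wT_lt_bckloss := by norm_num

/-- The BRIGHT world `(2, 4, 4)` (what `ω = 2` forces): leaf and residual both hold. [folklore] -/
def brightWorld : K4Web where
  w := 2
  w212 := 4
  wT := 4
  two_le_w := by norm_num
  w_le_record := by norm_num
  four_le_w212 := by norm_num
  five_thirds_le_w212 := by norm_num
  w212_le_w_add_two := by norm_num
  w212_le_wT := by norm_num
  four_le_wT := by norm_num
  wT_le_two_mul_w := by norm_num
  wT_lt_bckloss := by norm_num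

/-- The dark world satisfies the attacked leaf and violates the residual. [folklore] -/
theorem darkWorld_flat_and_saving : darkWorld.wT ≤ 4 ∧ ¬ 2 * darkWorld.w ≤ darkWorld.wT := by
  refine ⟨by norm_num [darkWorld], by norm_num [darkWorld]⟩

/-- The bright world satisfies both pieces. [folklore] -/
theorem brightWorld_flat_and_noSaving : brightWorld.wT ≤ 4 ∧ 2 * brightWorld.w ≤ brightWorld.wT := by
  refine ⟨by norm_num [brightWorld], by norm_num [brightWorld]⟩

/-- **The recorded web does not decide the residual, even granted the attacked leaf**: `wT ≤ 4 → 2w ≤ wT`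
fails in the dark world and holds in the bright one. Whatever closes item 33478 is an inequality outside
this list (and, by §2, outside the grouping class). [folklore] -/
theorem web_does_not_decide_residual :
    (¬ ∀ W : K4Web, W.wT ≤ 4 → 2 * W.w ≤ W.wT) ∧ (∃ W : K4Web, W.wT ≤ 4 ∧ 2 * W.w ≤ W.wT) := by
  refine ⟨fun hall => ?_, ⟨brightWorld, brightWorld_flat_and_noSaving⟩⟩
  have := hall darkWorld darkWorld_flat_and_saving.1
  exact darkWorld_flat_and_saving.2 this

/-- In the web the residual is EQUIVALENT to `w = 2` once the leaf is granted (`wT ≤ 4`): the abstract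
shadow of `matrixMultiplication_iff_tetra`. [folklore] -/
theorem web_residual_iff_two (W : K4Web) (hflat : W.wT ≤ 4) : 2 * W.w ≤ W.wT ↔ W.w = 2 := by
  constructor
  · intro h
    have := W.two_le_w
    linarith
  · intro h
    have := W.four_le_wT
    rw [h]
    linarith

end Web

end Summit.MatrixMultiplication.MatrixMultiplication.Theorems.TetraResidualAlternatives

end
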